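import Mathlib.RingTheory.Ideal.MinimalPrime.Noetherian
import Mathlib.RingTheory.Ideal.Height
import Mathlib.RingTheory.AlgebraicIndependent.Transcendental
import Mathlib.FieldTheory.Minpoly.Field
import Mathlib.FieldTheory.IsAlgClosed.Basic
import Literature.RingTheory.KrullDimension.FieldOfDefinition
import Literature.NumberTheory.Transcendental.LocusComponents
import HarnessLib

/-!
# Points of low-dimensional `k`-varieties in extension fields: transcendence bounds

Let `k → F` be fields with `F` algebraically closed, `J ⊆ k[X_ι]` an ideal (finitely many
variables) and `W = Z_F(J) ⊆ F^ι` its zero set, of dimension `dim W = dim F[X_ι] ⧸ I_F(W)`.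
We record the commutative algebra by which the *field of definition* `k` of `W` constrains the
points of `W` — including points with values in extension fields `K ⊇ F`, such as the generic
point of an `F`-irreducible curve lying on `W`:

* `ringKrullDim_quotient_le_of_zeroLocus` — **`dim k[X] ⧸ J ≤ dim W`** (every minimal prime of `J`
  extends to a component of `W` of the same dimension; Görtz–Wedhorn I, Prop. 5.38).
* `not_algebraicIndependent_pair_of_aeval_eq_zero` — if `dim W ≤ 1`, then for every zero
  `ζ ∈ K^ι` of `J` in a field `K ⊇ F ⊇ k`, **any two polynomial functions of `ζ` are algebraically
  dependent over `k`** (`trdeg_k k[ζ] ≤ dim k[X] ⧸ J ≤ 1`).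
* `mem_range_algebraMap_of_transcendental` — consequently, if a *transcendental* `t ∈ F` is a
  rational function of `ζ` over `k` (`t · g(ζ) = f(ζ)` with `f, g ∈ k[X]`, `g(ζ) ≠ 0`), then every
  coordinate of `ζ` lies in `F`: a constant of the curve through `ζ` that is a `k`-rational
  function on it is algebraic over `k` unless the curve is a point. This is the form in which
  "`W` is defined over `ℚ`" enters Hermite–Lindemann-type finiteness statements.
* small tools on zero sets used alongside: an infinite set of points meets some non-maximal
  prime component of its Zariski closure in infinitely many points
  (`exists_prime_infinite_inter_zeroLocus`), primes of `F[X, Y]` strictly between `0` and a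
  non-maximal prime do not exist (`isMaximal_of_bot_lt_of_lt`), and a prime containing all
  `Xᵢ - cᵢ` is maximal (`isMaximal_of_forall_X_sub_C_mem`).

## References

* U. Görtz, T. Wedhorn, *Algebraic Geometry I*, 2nd ed. (2020), Prop. 5.38.
* D. Marker, *Model theory of fields*, Lecture Notes in Logic 5 (2006), §1.
-/

noncomputable section

open MvPolynomial Set

universe u v

namespace Literature.NumberTheory.Transcendental

/-! ### Krull dimension of a quotient from its minimal primes -/

/-- `dim R ⧸ I ≤ m` as soon as `dim R ⧸ 𝔮 ≤ m` for every minimal prime `𝔮` of `I`: a chain of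
primes above `I` starts above a minimal prime of `I`. [folklore] -/
theorem ringKrullDim_quotient_le_of_minimalPrimes_le {R : Type*} [CommRing R] (I : Ideal R)
    (m : WithBot ℕ∞) (h : ∀ 𝔮 ∈ I.minimalPrimes, ringKrullDim (R ⧸ 𝔮) ≤ m) :
    ringKrullDim (R ⧸ I) ≤ m := by
  -- adapted from Literature.NumberTheory.Transcendental.ringKrullDim_quotient_le_of_minimalPrimes
  rw [ringKrullDim_quotient]
  refine iSup_le fun l => ?_
  have h0 : I ≤ (l 0).1.asIdeal := (l 0).2
  obtain ⟨𝔮, h𝔮, h𝔮le⟩ := Ideal.exists_minimalPrimes_le h0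
  have hmem : ∀ i, (l i).1 ∈ PrimeSpectrum.zeroLocus (𝔮 : Set R) := by
    intro i
    have hmono : (l 0).1 ≤ (l i).1 := l.monotone (Fin.zero_le _)
    intro x hx
    exact hmono (h𝔮le hx)
  let l' : LTSeries (PrimeSpectrum.zeroLocus (𝔮 : Set R)) :=
    ⟨l.length, fun i => ⟨(l i).1, hmem i⟩, fun i => l.step i⟩
  have h1 : (l'.length : WithBot ℕ∞) ≤ Order.krullDim (PrimeSpectrum.zeroLocus (𝔮 : Set R)) :=
    Order.LTSeries.length_le_krullDim l'
  rw [← ringKrullDim_quotient] at h1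
  exact h1.trans (h 𝔮 h𝔮)

/-! ### `dim k[X] ⧸ J ≤ dim Z_F(J)` -/

section BaseChange

variable {k F : Type u} [Field k] [Field F] [Algebra k F] {ι : Type} [Finite ι] [IsAlgClosed F]

attribute [local instance] MvPolynomial.algebraMvPolynomial

/-- A proper ideal of `k[X]` has an `F`-zero (`F` algebraically closed): a maximal ideal above it
is the ideal of an `F`-point. [folklore] -/
theorem zeroLocus_nonempty_of_isProper {J : Ideal (MvPolynomial ι k)} (hJ : J ≠ ⊤) :
    (zeroLocus F J).Nonempty := by
  obtain ⟨M, hM, hJM⟩ := Ideal.exists_le_maximal J hJ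
  obtain ⟨x, hx⟩ := eq_vanishingIdeal_singleton_of_isMaximal F hM
  refine ⟨x, mem_zeroLocus_iff.2 fun p hp => ?_⟩
  have : p ∈ vanishingIdeal k ({x} : Set (ι → F)) := hx ▸ hJM hp
  exact (mem_vanishingIdeal_singleton_iff x p).1 this

/-- The extension `𝔮·F[X]` of a proper ideal of `k[X]` is proper. [folklore] -/
theorem map_ne_top_of_ne_top {𝔮 : Ideal (MvPolynomial ι k)} (h𝔮 : 𝔮 ≠ ⊤) :
    𝔮.map (algebraMap (MvPolynomial ι k) (MvPolynomial ι F)) ≠ ⊤ := by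
  intro htop
  obtain ⟨x, hx⟩ := zeroLocus_nonempty_of_isProper (F := F) h𝔮
  have h1 : zeroLocus F (𝔮.map (MvPolynomial.map (algebraMap k F))) = zeroLocus F 𝔮 :=
    Literature.RingTheory.KrullDimension.zeroLocus_map 𝔮
  rw [MvPolynomial.algebraMap_def] at htop
  rw [htop, zeroLocus_top] at h1
  have : x ∈ (⊥ : Set (ι → F)) := h1.symm ▸ hx
  exact this

omit [Finite ι] [IsAlgClosed F] in
/-- The zero set of a minimal prime over `𝔮·F[X]` lies in `Z_F(𝔮)`. [folklore] -/
theorem zeroLocus_subset_of_mem_minimalPrimes_map {𝔮 : Ideal (MvPolynomial ι k)}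
    {Q : Ideal (MvPolynomial ι F)}
    (hQ : Q ∈ (𝔮.map (algebraMap (MvPolynomial ι k) (MvPolynomial ι F))).minimalPrimes) :
    zeroLocus F Q ⊆ zeroLocus F 𝔮 := by
  intro z hz
  rw [mem_zeroLocus_iff]
  intro f hf
  have h1 : MvPolynomial.map (algebraMap k F) f ∈ Q := by
    refine hQ.1.2 ?_
    rw [MvPolynomial.algebraMap_def]
    exact Ideal.mem_map_of_mem _ hf
  have := (mem_zeroLocus_iff.1 hz) _ h1
  rwa [aeval_map_algebraMap] at this

/-- **`dim k[X] ⧸ J ≤ dim Z_F(J)`** for an ideal `J ⊆ k[X]` over a subfield `k` of the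
algebraically closed field `F`: each minimal prime `𝔮` of `J` extends to a minimal prime `Q` of
`𝔮·F[X]` with `dim F[X] ⧸ Q = dim k[X] ⧸ 𝔮` (Görtz–Wedhorn I, Prop. 5.38), and `Z(Q) ⊆ Z_F(J)`.
[cite: GortzWedhorn2020, Prop. 5.38] -/
theorem ringKrullDim_quotient_le_of_zeroLocus (J : Ideal (MvPolynomial ι k)) :
    ringKrullDim (MvPolynomial ι k ⧸ J) ≤
      ringKrullDim (MvPolynomial ι F ⧸ vanishingIdeal F (zeroLocus F J)) := by
  refine ringKrullDim_quotient_le_of_minimalPrimes_le J _ fun 𝔮 h𝔮 => ?_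
  haveI h𝔮p : 𝔮.IsPrime := h𝔮.1.1
  have hJ𝔮 : J ≤ 𝔮 := h𝔮.1.2
  -- a minimal prime `Q` over `𝔮 F[X]`
  have hne := map_ne_top_of_ne_top (F := F) h𝔮p.ne_top
  obtain ⟨M, hM, hle⟩ := Ideal.exists_le_maximal _ hne
  obtain ⟨Q, hQ, -⟩ := Ideal.exists_minimalPrimes_le hle
  haveI hQp : Q.IsPrime := hQ.1.1
  have hdimQ : ringKrullDim (MvPolynomial ι F ⧸ Q) = ringKrullDim (MvPolynomial ι k ⧸ 𝔮) :=
    LocusComponents.ringKrullDim_quotient_eq_of_mem_minimalPrimes_map hQ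
  rw [← hdimQ]
  -- `I_F(Z_F(J)) ≤ Q`
  have hsub : zeroLocus F Q ⊆ zeroLocus F J :=
    (zeroLocus_subset_of_mem_minimalPrimes_map hQ).trans (zeroLocus_anti_mono hJ𝔮)
  have hIQ : vanishingIdeal F (zeroLocus F J) ≤ Q := by
    have h1 : vanishingIdeal F (zeroLocus F J) ≤ vanishingIdeal F (zeroLocus F Q) :=
      vanishingIdeal_anti_mono hsub
    rwa [MvPolynomial.IsPrime.vanishingIdeal_zeroLocus Q] at h1
  exact ringKrullDim_le_of_surjective (Ideal.Quotient.factor hIQ) (Ideal.Quotient.factor_surjective hIQ)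

end BaseChange

/-! ### Transcendence bounds for points in extension fields -/

section Points

variable {k F : Type u} [Field k] [Field F] [Algebra k F] {ι : Type} [Finite ι] [IsAlgClosed F]
variable {K : Type v} [Field K] [Algebra k K]

/-- **Two polynomial functions of a point of a `k`-variety of dimension `≤ 1` are algebraically
dependent over `k`.** If `dim Z_F(J) ≤ 1` (`J ⊆ k[X]`) and `ζ ∈ K^ι` is a zero of `J` in any
field `K ⊇ k`, then `trdeg_k k[ζ] ≤ dim k[X] ⧸ J ≤ 1`, so no pair `p₁(ζ), p₂(ζ)` is algebraically
independent over `k`. [cite: GortzWedhorn2020, Prop. 5.38] -/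
theorem not_algebraicIndependent_pair_of_aeval_eq_zero (J : Ideal (MvPolynomial ι k))
    (hdim : ringKrullDim (MvPolynomial ι F ⧸ vanishingIdeal F (zeroLocus F J)) ≤ 1)
    (ζ : ι → K) (hζ : ∀ f ∈ J, aeval ζ f = 0) (v : Fin 2 → MvPolynomial ι k) :
    ¬ AlgebraicIndependent k (fun j => aeval ζ (v j)) := by
  classical
  intro hind
  set 𝔭 : Ideal (MvPolynomial ι k) := RingHom.ker (aeval ζ : MvPolynomial ι k →ₐ[k] K) with h𝔭
  haveI : 𝔭.IsPrime := RingHom.ker_isPrime _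
  set B := MvPolynomial ι k ⧸ 𝔭 with hB
  haveI : IsDomain B := Ideal.Quotient.isDomain 𝔭
  haveI : Algebra.FiniteType k B :=
    Algebra.FiniteType.of_surjective (Ideal.Quotient.mkₐ k 𝔭) (Ideal.Quotient.mkₐ_surjective k 𝔭)
  -- `dim B ≤ 1`
  have hJ𝔭 : J ≤ 𝔭 := fun f hf => (RingHom.mem_ker).2 (hζ f hf)
  have hdimB : ringKrullDim B ≤ 1 :=
    (ringKrullDim_le_of_surjective (Ideal.Quotient.factor hJ𝔭)
      (Ideal.Quotient.factor_surjective hJ𝔭)).trans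
      ((ringKrullDim_quotient_le_of_zeroLocus (F := F) J).trans hdim)
  -- `trdeg_k B ≤ 1`
  obtain ⟨s, hs, ht⟩ := Literature.RingTheory.KrullDimension.exists_ringKrullDim_eq_and_trdeg_eq k B
  have hs1 : s ≤ 1 := by
    rw [hs] at hdimB
    exact_mod_cast hdimB
  -- the family in `B`
  let φ : B →ₐ[k] K := Ideal.Quotient.liftₐ 𝔭 (aeval ζ) fun a ha => ha
  let w : Fin 2 → B := fun j => Ideal.Quotient.mk 𝔭 (v j)
  have hφw : (fun j => aeval ζ (v j)) = φ ∘ w := by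
    funext j
    rfl
  rw [hφw] at hind
  have hw : AlgebraicIndependent k w := AlgebraicIndependent.of_comp φ hind
  have hcard := hw.lift_cardinalMk_le_trdeg
  rw [ht, Cardinal.mk_fin, Cardinal.lift_natCast, Cardinal.lift_natCast] at hcard
  norm_cast at hcard
  omega

/-- **A transcendental constant which is a `k`-rational function of a point of a `k`-variety of
dimension `≤ 1` forces the point to be constant.** Let `dim Z_F(J) ≤ 1` (`J ⊆ k[X]`, `F`
algebraically closed), `K ⊇ F ⊇ k` fields and `ζ ∈ K^ι` a zero of `J`. If `t ∈ F` is
transcendental over `k` and `t · g(ζ) = f(ζ)` for some `f, g ∈ k[X]` with `g(ζ) ≠ 0`, then every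
coordinate `ζᵢ` lies in `F`. (For each `i`: `t` and `ζᵢ` are algebraically dependent over `k`,
so `ζᵢ` is algebraic over `k(t) ⊆ F`, hence `ζᵢ ∈ F`.) [cite: GortzWedhorn2020, Prop. 5.38] -/
theorem mem_range_algebraMap_of_transcendental [Algebra F K] [IsScalarTower k F K]
    (J : Ideal (MvPolynomial ι k))
    (hdim : ringKrullDim (MvPolynomial ι F ⧸ vanishingIdeal F (zeroLocus F J)) ≤ 1)
    (ζ : ι → K) (hζ : ∀ f ∈ J, aeval ζ f = 0) {t : F} (ht : Transcendental k t)
    (f g : MvPolynomial ι k) (hg : aeval ζ g ≠ 0)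
    (hrel : algebraMap F K t * aeval ζ g = aeval ζ f) (i : ι) :
    ζ i ∈ (algebraMap F K).range := by
  classical
  have hdep := not_algebraicIndependent_pair_of_aeval_eq_zero (F := F) J hdim ζ hζ
  set tK := algebraMap F K t with htK
  have hinjFK : Function.Injective (algebraMap F K) := (algebraMap F K).injective
  have htK : Transcendental k tK := by
    intro halg
    exact ht ((isAlgebraic_algebraMap_iff hinjFK).1 halg)
  set a := ζ i with ha
  -- Step 1: `a` is algebraic over `k[tK]`
  have step1 : IsAlgebraic (Algebra.adjoin k {tK}) a := by
    by_cases halg : IsAlgebraic k a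
    · exact halg.extendScalars (R := k) (S := Algebra.adjoin k {tK})
        (FaithfulSMul.algebraMap_injective k _)
    · -- `a` transcendental over `k`: `g(ζ), f(ζ)` are algebraic over `k[a]`, hence so is `tK`
      have hta : Transcendental k a := halg
      have hinda : AlgebraicIndependent k ![a] :=
        (algebraicIndependent_unique_type_iff (x := ![a])).2 hta
      have hrange : Set.range ![a] = {a} := by
        ext x
        simp
      -- any `p(ζ)` is algebraic over `k[a]`
      have halga : ∀ p : MvPolynomial ι k, IsAlgebraic (Algebra.adjoin k {a}) (aeval ζ p) := by
        intro p
        by_contra htr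
        have htr' : Transcendental (Algebra.adjoin k (Set.range ![a])) (aeval ζ p) := by
          rwa [hrange]
        have h2 := (hinda.option_iff_transcendental (aeval ζ p)).2 htr'
        -- reindex to a `Fin 2`-family of values of polynomials
        have h3 : AlgebraicIndependent k (fun j : Fin 2 => aeval ζ (![p, X i] j)) := by
          have h1' : (finSuccEquiv 1) 1 = some 0 := finSuccEquiv_succ 0
          have h4 : (fun j : Fin 2 => aeval ζ (![p, X i] j)) =
              (fun o : Option (Fin 1) => o.elim (aeval ζ p) ![a]) ∘ finSuccEquiv 1 := by
            funext j
            fin_cases j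
            · simp
            · simp [ha, h1']
          rw [h4]
          exact (algebraicIndependent_equiv (finSuccEquiv 1)).2 h2
        exact hdep ![p, X i] h3
      have hga : IsAlgebraic (Algebra.adjoin k {a}) (aeval ζ g) := halga g
      have hfa : IsAlgebraic (Algebra.adjoin k {a}) (aeval ζ f) := halga f
      have htKa : IsAlgebraic (Algebra.adjoin k {a}) tK := by
        have hg' : aeval ζ g ∈ nonZeroDivisors K := mem_nonZeroDivisors_of_ne_zero hg
        refine IsAlgebraic.of_mul hg' hga ?_
        rw [mul_comm, hrel]
        exact hfa
      -- exchange: `tK` algebraic over `k[a]` and transcendental over `k` ⇒ `a` algebraic over `k[tK]`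
      by_contra htr
      have hindt : AlgebraicIndependent k ![tK] :=
        (algebraicIndependent_unique_type_iff (x := ![tK])).2 htK
      have hranget : Set.range ![tK] = {tK} := by
        ext x
        simp
      have htr' : Transcendental (Algebra.adjoin k (Set.range ![tK])) a := by rwa [hranget]
      have h2 := (hindt.option_iff_transcendental a).2 htr'
      -- swap the two entries
      have h3 : AlgebraicIndependent k (fun o : Option (Fin 1) => o.elim tK ![a]) := by
        have h1' : (finSuccEquiv 1) 1 = some 0 := finSuccEquiv_succ 0
        have h4 : (fun o : Option (Fin 1) => o.elim tK ![a]) =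
            (fun o : Option (Fin 1) => o.elim a ![tK]) ∘
              (finSuccEquiv 1).symm.trans ((Equiv.swap (0 : Fin 2) 1).trans (finSuccEquiv 1)) := by
          funext o
          rcases o with _ | j
          · simp [h1']
          · fin_cases j
            have h5 : (finSuccEquiv 1).symm (some 0) = 1 := finSuccEquiv_symm_some 0
            simp [h5]
        rw [h4]
        exact (algebraicIndependent_equiv _).2 h2
      have h5 := (hinda.option_iff_transcendental tK).1 h3
      rw [hrange] at h5
      exact h5 htKa
  -- Step 2: hence `a` is algebraic over `F`
  have step2 : IsAlgebraic F a := by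
    -- `k[tK]` is contained in the image of `F`
    let FK : Subalgebra k K := (IsScalarTower.toAlgHom k F K).range
    have hle : Algebra.adjoin k {tK} ≤ FK := by
      rw [Algebra.adjoin_le_iff, Set.singleton_subset_iff]
      exact ⟨t, rfl⟩
    have h1 : IsAlgebraic FK a := step1.tower_top_of_subalgebra_le hle
    -- transfer along `F ≃ FK`
    let e : F →+* FK := (IsScalarTower.toAlgHom k F K).rangeRestrict.toRingHom
    have he : Function.Surjective e := (IsScalarTower.toAlgHom k F K).rangeRestrict_surjective
    refine h1.of_ringHom_of_comp_eq e (RingHom.id K) he Function.injective_id ?_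
    ext x
    rfl
  -- Step 3: `F` algebraically closed, so `a ∈ F`
  have hint : IsIntegral F a := step2.isIntegral
  have hdeg : (minpoly F a).degree = 1 :=
    IsAlgClosed.degree_eq_one_of_irreducible F (minpoly.irreducible hint)
  exact minpoly.degree_eq_one_iff.1 hdeg

end Points

/-! ### Small tools on zero sets -/

section Tools

variable {F : Type u} [Field F] {ι : Type} [Finite ι]

omit [Finite ι] in
/-- Vanishing ideals are radical. [folklore] -/
theorem isRadical_vanishingIdeal_points (V : Set (ι → F)) : (vanishingIdeal F V).IsRadical := by
  rintro p ⟨n, hn⟩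
  rw [mem_vanishingIdeal_iff] at hn ⊢
  intro x hx
  have := hn x hx
  rw [map_pow] at this
  exact pow_eq_zero_iff'.1 this |>.1

omit [Finite ι] in
/-- The zero set of an ideal with two distinct zeros is not the zero set of a maximal ideal: a
maximal ideal with a zero `x` is the ideal of `x`, whose only zero is `x`. [folklore] -/
theorem not_isMaximal_of_mem_zeroLocus_of_ne {P : Ideal (MvPolynomial ι F)} {x y : ι → F}
    (hx : x ∈ zeroLocus F P) (hy : y ∈ zeroLocus F P) (hxy : x ≠ y) : ¬ P.IsMaximal := by
  intro hP
  have hle : P ≤ vanishingIdeal F ({x} : Set (ι → F)) := fun p hp =>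
    (mem_vanishingIdeal_singleton_iff x p).2 ((mem_zeroLocus_iff.1 hx) p hp)
  have heq : P = vanishingIdeal F ({x} : Set (ι → F)) :=
    (hP.eq_of_le (Ideal.IsPrime.ne_top inferInstance) hle)
  apply hxy
  funext i
  have hi : (X i - C (x i) : MvPolynomial ι F) ∈ P := by
    rw [heq, mem_vanishingIdeal_singleton_iff]
    simp
  have := (mem_zeroLocus_iff.1 hy) _ hi
  simp only [map_sub, aeval_X, aeval_C, Algebra.algebraMap_self, RingHom.id_apply] at this
  exact (sub_eq_zero.1 this).symm

omit [Finite ι] in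
/-- A prime ideal of `F[X]` containing `Xᵢ - cᵢ` for all `i` is the (maximal) ideal of the point
`c`. [folklore] -/
theorem isMaximal_of_forall_X_sub_C_mem {P : Ideal (MvPolynomial ι F)} [hP : P.IsPrime]
    (c : ι → F) (h : ∀ i, (X i - C (c i) : MvPolynomial ι F) ∈ P) : P.IsMaximal := by
  have hle : vanishingIdeal F ({c} : Set (ι → F)) ≤ P := by
    intro p hp
    rw [mem_vanishingIdeal_singleton_iff] at hp
    -- `p ≡ p(c)` modulo the ideal generated by the `Xᵢ - cᵢ`
    have key : ∀ q : MvPolynomial ι F, q - C (aeval c q) ∈ P := by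
      intro q
      induction q using MvPolynomial.induction_on with
      | C a => simp
      | add p q hp hq =>
        have : p + q - C (aeval c (p + q)) = (p - C (aeval c p)) + (q - C (aeval c q)) := by
          simp only [map_add]; ring
        rw [this]
        exact P.add_mem hp hq
      | mul_X p i hp =>
        have : p * X i - C (aeval c (p * X i)) =
            (p - C (aeval c p)) * X i + C (aeval c p) * (X i - C (c i)) := by
          simp only [map_mul, aeval_X]; ring
        rw [this]
        exact P.add_mem (P.mul_mem_right _ hp) (P.mul_mem_left _ (h i))
    have := key p
    rwa [hp, map_zero, sub_zero] at this
  have hmax : (vanishingIdeal F ({c} : Set (ι → F))).IsMaximal := inferInstance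
  rw [← hmax.eq_of_le hP.ne_top hle]
  exact hmax

/-- **In `F[X₀, X₁]` there is no room for two primes strictly between `0` and a non-maximal
prime**: if `0 ≠ Q₁ < Q₂` are primes of `F[X₀, X₁]` then `Q₂` is maximal (`dim F[X₀, X₁] = 2`).
[folklore] -/
theorem isMaximal_of_bot_lt_of_lt {Q₁ Q₂ : Ideal (MvPolynomial (Fin 2) F)} [Q₁.IsPrime]
    [Q₂.IsPrime] (h0 : Q₁ ≠ ⊥) (h12 : Q₁ < Q₂) : Q₂.IsMaximal := by
  have hdim : ringKrullDim (MvPolynomial (Fin 2) F) = ((2 : ℕ∞) : WithBot ℕ∞) := by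
    rw [MvPolynomial.ringKrullDim_of_isNoetherianRing, ringKrullDim_eq_zero_of_field, zero_add,
      Nat.card_eq_fintype_card, Fintype.card_fin]
    norm_cast
  haveI : FiniteRingKrullDim (MvPolynomial (Fin 2) F) := by
    rw [finiteRingKrullDim_iff_ne_bot_and_top, hdim]
    exact ⟨WithBot.coe_ne_bot, by decide⟩
  have h1 : 1 ≤ Q₁.height := by
    rw [Order.one_le_iff_ne_zero, Ne, Ideal.height_eq_zero_iff_eq_bot]
    exact h0
  have h2 : Q₁.height + 1 ≤ Q₂.height := Ideal.height_add_one_le_of_lt_of_isPrime h12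
  have h3 : (Q₂.height : WithBot ℕ∞) ≤ ((2 : ℕ∞) : WithBot ℕ∞) :=
    hdim ▸ Ideal.height_le_ringKrullDim_of_isPrime
  have h3' : Q₂.height ≤ 2 := WithBot.coe_le_coe.1 h3
  have h4 : (2 : ℕ∞) ≤ Q₂.height :=
    calc (2 : ℕ∞) = 1 + 1 := by norm_num
      _ ≤ Q₁.height + 1 := add_le_add h1 le_rfl
      _ ≤ Q₂.height := h2
  refine Ideal.isMaximal_of_height_eq_ringKrullDim ?_
  rw [hdim, le_antisymm h3' h4]

/-- **An infinite set of points meets some curve-or-bigger component of its closure infinitely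
often.** For an infinite `H ⊆ F^ι` there is a prime `P ⊇ I_F(H)` which is not maximal and whose
zero set contains infinitely many points of `H` (the minimal primes of the radical ideal `I_F(H)`
are finitely many and their zero sets cover `H`; a maximal one would contribute one point).
[folklore] -/
theorem exists_prime_infinite_inter_zeroLocus {H : Set (ι → F)} (hH : H.Infinite) :
    ∃ P : Ideal (MvPolynomial ι F), P.IsPrime ∧ vanishingIdeal F H ≤ P ∧ ¬ P.IsMaximal ∧
      (H ∩ zeroLocus F P).Infinite := by
  classical
  set I : Ideal (MvPolynomial ι F) := vanishingIdeal F H with hI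
  have hfin : I.minimalPrimes.Finite := Ideal.finite_minimalPrimes_of_isNoetherianRing _ I
  -- the zero sets of the minimal primes cover `H`
  have hcover : H ⊆ ⋃ P ∈ hfin.toFinset, (H ∩ zeroLocus F P) := by
    intro x hx
    by_contra hnot
    simp only [Set.mem_iUnion, Set.mem_inter_iff, Set.Finite.mem_toFinset, exists_prop,
      not_exists, not_and] at hnot
    -- for each minimal prime pick a polynomial of it not vanishing at `x`
    have hpick : ∀ P ∈ I.minimalPrimes, ∃ f ∈ P, aeval x f ≠ 0 := by
      intro P hP
      have := hnot P hP hx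
      rw [mem_zeroLocus_iff] at this
      push Not at this
      exact this
    choose! f hf hfx using hpick
    have hprod' : (∏ P ∈ hfin.toFinset, f P) ∈ I.radical := by
      rw [← Ideal.sInf_minimalPrimes, Ideal.mem_sInf]
      intro P hP
      exact Ideal.prod_mem P ((Set.Finite.mem_toFinset hfin).2 hP) (hf P hP)
    have hprod : (∏ P ∈ hfin.toFinset, f P) ∈ I := isRadical_vanishingIdeal_points H hprod'
    have hval : aeval x (∏ P ∈ hfin.toFinset, f P) = 0 := (mem_vanishingIdeal_iff.1 hprod) x hx
    rw [map_prod, Finset.prod_eq_zero_iff] at hval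
    obtain ⟨P, hP, hP0⟩ := hval
    exact hfx P ((Set.Finite.mem_toFinset hfin).1 hP) hP0
  -- pigeonhole
  have hex : ∃ P ∈ hfin.toFinset, (H ∩ zeroLocus F P).Infinite := by
    by_contra hall
    push Not at hall
    have : (⋃ P ∈ hfin.toFinset, (H ∩ zeroLocus F P)).Finite :=
      Set.Finite.biUnion (Finset.finite_toSet _) fun P hP => hall P hP
    exact hH (this.subset hcover)
  obtain ⟨P, hP, hinf⟩ := hex
  rw [Set.Finite.mem_toFinset] at hP
  refine ⟨P, hP.1.1, hP.1.2, ?_, hinf⟩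
  -- not maximal: two distinct zeros
  obtain ⟨x, hx, y, hy, hxy⟩ := hinf.nontrivial
  exact not_isMaximal_of_mem_zeroLocus_of_ne hx.2 hy.2 hxy

end Tools

end Literature.NumberTheory.Transcendental
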